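import Mathlib
import HarnessLib
import Literature.Analysis.FluidPDE.TypeIAncientMild
import Summits.NavierStokesRegularity.NavierStokesRegularity.Theorems.PoloidalWindowDoorPoloidalWindowRigidityPoloidalExtremal
import Summits.NavierStokesRegularity.NavierStokesRegularity.Theorems.PoloidalWindowDoorPoloidalWindowRigidityPoloidalExtremalFarPast

/-!
# Route `PoloidalWindowDoor`, crux `PoloidalWindowRigidity` (K2, stmt-NavierStokesRegularity-19708) —
# BLOW-DOWNS of an extremal poloidal profile are extremal poloidal profiles (normal form for the residue S2′, part 3)

Cell ns-regularity-ideate, K2 lead ns-poloidal-K2-p1 (support file, `--supports stmt-…-19708 --as helper`; task (H1c) of the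
lead's PICKED.md; companions `…PoloidalExtremal` (p469616: existence of an extremal poloidal frozen element, closedness of the
sub-class under KNSS gradient limits and under the symmetries) and `…PoloidalExtremalFarPast` (p470378: far-past saturation)).

Following route `ExtremalTypeIConstant`'s `extremal_blowDown_extremal` (KNSS 2009 Prop. 4.1/§6) INSIDE the poloidal frozen sub-class:
an extremal pair `(C, u)` nearly attains its bound at points `(t_k, x_k)`, `t_k < −(k+1)²`; renormalising them to `(−1, 0)` by
translation and parabolic scaling `λ_k = √(−t_k) → ∞` (the sub-class is invariant) and extracting a KNSS limit (fields AND gradients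
converge, so the limit is again poloidal and frozen) produces a BLOW-DOWN `W(t,x) = lim λ_j u(λ_j² t, x_j + λ_j x)` which is again an
extremal poloidal pair `(C, W)`: `‖W(−1,0)‖ = C`.  This is the α-limit step of any recurrence approach to S2′; the Birkhoff/Zorn
step («some extremal poloidal profile is a blow-down of ITSELF», tree pattern `exists_selfBlowDown_of_forall_exists_blowDown`) is
left to a worker (H1d).

* `poloidal_extremal_blowDown_extremal`.

WHAT THIS IS NOT: not a claim about Navier–Stokes regularity and not the residue — a normal-form lemma (bears_on LADDER-NS N0,
rung N0-LocalTubeDoorPoloidal).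
-/

noncomputable section

-- the summit and its single sub-problem share the name (CONVENTIONS §1), as in every Theorems file
set_option linter.dupNamespace false

namespace Summit.NavierStokesRegularity.NavierStokesRegularity.Theorems.PoloidalWindowDoorPoloidalWindowRigidityPoloidalExtremalBlowDown

open MeasureTheory Set Function Filter Topology
open scoped RealInnerProductSpace InnerProductSpace
open Literature.Analysis Literature.Analysis.FluidPDE
open Summit.NavierStokesRegularity.NavierStokesRegularity.Theorems
open Summit.NavierStokesRegularity.NavierStokesRegularity.Theorems.PoloidalWindowDoorPoloidalWindowRigidityPoloidalExtremal
open Summit.NavierStokesRegularity.NavierStokesRegularity.Theorems.PoloidalWindowDoorPoloidalWindowRigidityPoloidalExtremalFarPast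

/-- **Blow-downs of an extremal poloidal pair are extremal poloidal pairs.**  Let `(C, u)` be extremal in the poloidal frozen
sub-class of the KNSS Type-I ancient mild class (`C > 0`, `‖u(−1,0)‖ = C`, `C` minimal among the constants of nontrivial poloidal
frozen elements).  Then there are scales `λ_j → ∞`, centres `x_j` and a field `W` with `λ_j u(λ_j² t, x_j + λ_j x) → W(t,x)` for all
`t < 0`, `x`, such that `W ∈ 𝔓(C)` is poloidal and frozen with `‖W(−1,0)‖ = C` (so `(C, W)` is again extremal, minimality being a
property of `C`). -/
theorem poloidal_extremal_blowDown_extremal {C : ℝ} {u : ℝ → EuclideanSpace ℝ (Fin 3) → EuclideanSpace ℝ (Fin 3)}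
    (hC : 0 < C) (hA : IsTypeIAncientMild C u)
    (hpol : ∀ s < 0, ∀ y, ⟪curl (u s) y, EuclideanSpace.single 2 (1 : ℝ)⟫_ℝ = 0)
    (hfro : ∀ s < 0, ∀ y, ⟪fderiv ℝ (u s) y (curl (u s) y), EuclideanSpace.single 2 (1 : ℝ)⟫_ℝ = 0)
    (hnorm : ‖u (-1) 0‖ = C)
    (hmin : ∀ (C' : ℝ) (u' : ℝ → EuclideanSpace ℝ (Fin 3) → EuclideanSpace ℝ (Fin 3)), IsTypeIAncientMild C' u' →
      (∀ s < 0, ∀ y, ⟪curl (u' s) y, EuclideanSpace.single 2 (1 : ℝ)⟫_ℝ = 0) →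
      (∀ s < 0, ∀ y, ⟪fderiv ℝ (u' s) y (curl (u' s) y), EuclideanSpace.single 2 (1 : ℝ)⟫_ℝ = 0) →
      (∃ t < 0, ∃ x, u' t x ≠ 0) → C ≤ C') :
    ∃ (lam : ℕ → ℝ) (xs : ℕ → EuclideanSpace ℝ (Fin 3)) (W : ℝ → EuclideanSpace ℝ (Fin 3) → EuclideanSpace ℝ (Fin 3)),
      (∀ j, 0 < lam j) ∧ Tendsto lam atTop atTop ∧
      (∀ t < (0 : ℝ), ∀ x, Tendsto (fun j => lam j • u (lam j ^ 2 * t) (xs j + lam j • x)) atTop (𝓝 (W t x))) ∧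
      IsTypeIAncientMild C W ∧
      (∀ s < 0, ∀ y, ⟪curl (W s) y, EuclideanSpace.single 2 (1 : ℝ)⟫_ℝ = 0) ∧
      (∀ s < 0, ∀ y, ⟪fderiv ℝ (W s) y (curl (W s) y), EuclideanSpace.single 2 (1 : ℝ)⟫_ℝ = 0) ∧
      ‖W (-1) 0‖ = C := by
  have hsat : ∀ ε : ℝ, 0 < ε → ∀ T : ℝ, T < 0 → ∃ t < T, ∃ x : EuclideanSpace ℝ (Fin 3),
      (C - ε) / Real.sqrt (-t) < ‖u t x‖ := fun ε hε T hT =>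
    poloidal_extremal_farPast_saturation hC hA hpol hfro hnorm hmin hε hT
  -- saturating far-past points `(t_k, x_k)`, `t_k < -(k+1)²`
  have hpts : ∀ k : ℕ, ∃ t < -(((k : ℝ) + 1) ^ 2), ∃ x : EuclideanSpace ℝ (Fin 3),
      (C - 1 / ((k : ℝ) + 1)) / Real.sqrt (-t) < ‖u t x‖ := fun k =>
    hsat (1 / ((k : ℝ) + 1)) (by positivity) (-(((k : ℝ) + 1) ^ 2)) (neg_neg_of_pos (by positivity))
  choose tk htk xk hxk using hpts
  have htk0 : ∀ k, tk k < 0 := fun k => (htk k).trans (neg_neg_of_pos (by positivity))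
  -- scales and renormalised fields
  set lam : ℕ → ℝ := fun k => Real.sqrt (-tk k) with hlam
  have hlam_pos : ∀ k, 0 < lam k := fun k => Real.sqrt_pos.2 (neg_pos.2 (htk0 k))
  have hlam_gt : ∀ k : ℕ, (k : ℝ) + 1 < lam k := fun k => by
    have h1 : ((k : ℝ) + 1) ^ 2 < -tk k := by linarith [htk k]
    calc (k : ℝ) + 1 = Real.sqrt (((k : ℝ) + 1) ^ 2) := (Real.sqrt_sq (by positivity)).symm
      _ < Real.sqrt (-tk k) := Real.sqrt_lt_sqrt (by positivity) h1
  have hlam_top : Tendsto lam atTop atTop := by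
    refine tendsto_atTop_mono (fun k => (hlam_gt k).le) ?_
    exact tendsto_atTop_add_const_right _ 1 tendsto_natCast_atTop_atTop
  set v : ℕ → ℝ → EuclideanSpace ℝ (Fin 3) → EuclideanSpace ℝ (Fin 3) := fun k =>
    nsRescale (lam k) (fun t x => u t (xk k + x)) with hv
  have hvA : ∀ k, IsTypeIAncientMild C (v k) := fun k =>
    isTypeIAncientMild_nsRescale (isTypeIAncientMild_translate hA (xk k)) (hlam_pos k)
  have hvpol : ∀ k, ∀ s < 0, ∀ y, ⟪curl (v k s) y, EuclideanSpace.single 2 (1 : ℝ)⟫_ℝ = 0 := fun k =>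
    poloidal_nsRescale (poloidal_translate hpol (xk k)) (hlam_pos k)
  have hvfro : ∀ k, ∀ s < 0, ∀ y,
      ⟪fderiv ℝ (v k s) y (curl (v k s) y), EuclideanSpace.single 2 (1 : ℝ)⟫_ℝ = 0 := fun k =>
    frozen_nsRescale (frozen_translate hfro (xk k)) (hlam_pos k)
  have hv_apply : ∀ k t x, v k t x = lam k • u (lam k ^ 2 * t) (xk k + lam k • x) := fun k t x => by
    simp [hv, nsRescale_apply]
  -- the value at the hot spot: `‖v_k(-1, 0)‖ = √(-t_k) ‖u(t_k, x_k)‖ > C - 1/(k+1)`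
  have hv_hot : ∀ k : ℕ, C - 1 / ((k : ℝ) + 1) < ‖v k (-1) 0‖ := by
    intro k
    have e1 : lam k ^ 2 * (-1 : ℝ) = tk k := by
      rw [hlam]; simp only
      rw [Real.sq_sqrt (neg_pos.2 (htk0 k)).le]; ring
    rw [hv_apply, e1, smul_zero, add_zero, norm_smul, Real.norm_of_nonneg (hlam_pos k).le]
    have h := hxk k
    rw [div_lt_iff₀ (hlam_pos k)] at h
    linarith [h]
  -- KNSS compactness, fields AND gradients
  obtain ⟨φ, hφ, W, hW, hpt, hDpt, -, -⟩ := exists_tendsto_of_isTypeIAncientMild_seq C hvA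
  refine ⟨fun j => lam (φ j), fun j => xk (φ j), W, fun j => hlam_pos _, hlam_top.comp hφ.tendsto_atTop,
    fun t ht x => ?_, hW, fun s hs y => poloidal_of_tendsto (hDpt s hs y) fun j => hvpol (φ j) s hs y,
    fun s hs y => frozen_of_tendsto (hDpt s hs y) fun j => hvfro (φ j) s hs y, ?_⟩
  · simpa only [hv_apply] using hpt t ht x
  · -- `‖W(-1,0)‖ = C`: `≤` from the class, `≥` from the hot values in the limit
    have hup : ‖W (-1) 0‖ ≤ C := by
      have h := hW.norm_le (show (-1 : ℝ) < 0 by norm_num) 0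
      rwa [neg_neg, Real.sqrt_one, div_one] at h
    have hlim : Tendsto (fun j => ‖v (φ j) (-1) 0‖) atTop (𝓝 ‖W (-1) 0‖) :=
      (hpt (-1) (by norm_num) 0).norm
    have hlow : C ≤ ‖W (-1) 0‖ := by
      have hCj : Tendsto (fun j : ℕ => C - 1 / (((φ j : ℕ) : ℝ) + 1)) atTop (𝓝 (C - 0)) := by
        refine tendsto_const_nhds.sub ?_
        have h1 : Tendsto (fun j : ℕ => ((φ j : ℕ) : ℝ) + 1) atTop atTop :=
          tendsto_atTop_add_const_right _ 1
            (tendsto_natCast_atTop_atTop.comp hφ.tendsto_atTop)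
        have h2 := tendsto_inv_atTop_zero.comp h1
        simpa [Function.comp_def, one_div] using h2
      rw [sub_zero] at hCj
      exact le_of_tendsto_of_tendsto' hCj hlim fun j => (hv_hot (φ j)).le
    exact le_antisymm hup hlow

end Summit.NavierStokesRegularity.NavierStokesRegularity.Theorems.PoloidalWindowDoorPoloidalWindowRigidityPoloidalExtremalBlowDown
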